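import Summits.Ventures.LatticeQCDFlow.Scaling.DoeblinHotWarmStart
import Summits.Ventures.LatticeQCDFlow.Scaling.WarmStartHybrid

/-!
HONEST FRAMING: exact (Metropolis-corrected) sampling algorithms for lattice gauge theory; figures
of merit are autocorrelation/cost numbers at stated couplings and volumes; no continuum-physics
claim.

# DoeblinHotWarmStartHybrid — WARM STARTS FROM ARBITRARY AND APPROXIMATE REPLICAS WITH A DOEBLIN-MINORISED HOT SAMPLER:
# `‖(⊗g)Pⁿ − π̃‖_TV ≤ ((2·#(D₀∖{0}) + p·𝟙{0∈D₀})/p)·(1 − tcp/(2m))ⁿ` ONCE `4t ≤ p(1−t)·a·w_0`, PLUS `Σ_{j∉D₀} ε_j` FOR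
# `ε_j`-CLOSE REPLICAS OFF `D₀` (lean-2 GEN-27, ours)

Venture-side (OURS).  Cell `lqcd-flow` (pub-lqcd), unit `pub-lqcd-lean-2-g27`, 2026-08-27/28.  Chapter M re-run for
realistic flows, file 12: `Scaling/DoeblinHotWarmStart` (pinned starts, hot kernel only `μ_0`-stationary with
`M_0(u,·) ≥ a·μ_0(·)`) combined with the convexity of `Scaling/WarmStartHybrid`.  Setting: hub list `e_r = (0, κ_r+1)`,
maps `φ_r`, positive unit-mass laws, `μ_k`-stationary row-stochastic kernels at every level, weights `w`, one-sided
domination `p`, regime `4t ≤ p(1−t)·a·w_0`, multiplicities `≥ c ≥ 1`; `P = t·GSw + (1−t)·Π_w^M`.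

## What is proved

* **`doeblinHybridStart_tvDist_le`** — replicas in `D₀` with ANY product law, exact off `D₀`:
  `‖(⊗g)Pⁿ − π̃‖_TV ≤ ((2·#(D₀∖{0}) + p·𝟙{0 ∈ D₀})/p)·(1 − tcp/(2m))ⁿ`;
  **`doeblinHybridStart_tvDist_le_of_ge_log`** — `≤ ε` once `n ≥ (2m/(tcp))·log((2·#(D₀∖{0}) + p·𝟙{0∈D₀})/(pε))`.
* **`doeblinApproxStart_tvDist_le_of_ge_log`** — replicas off `D₀` only `ε_j`-close to `μ_j`: `≤ Σ_{j∉D₀} ε_j + ε` at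
  the same time; `uniformDoeblinApproxStart_tvDist_le_of_ge_log` — `m = cK`: the time is `(2K/(tp))·log(…)`.

Reading (no numerics implied): for a flow-assisted tempering run whose hot move is an independence sampler with
importance weights bounded by `1/a`, re-initialising `j` replicas anyhow while the others are `ε_j`-close costs
`(2K/(tp))·log((2j+p)/(pε))` steps to get back within `ε + Σε_j` — the exact-sampler statement with `w_0 ↦ a·w_0` in
the regime only.  NOT CLAIMED: correlated initial laws; the regime restriction for imperfect maps; anything measured.
Literature grade (cell rule): OWN RESULT; nothing cited as a fact; no new bib keys.
-/

noncomputable section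

open Finset Function
open Literature.Probability.MarkovChains

namespace Summit.Ventures.LatticeQCDFlow.Scaling

variable {S : Type*} [Fintype S] [DecidableEq S] {K m : ℕ} {μ : Fin (K + 1) → S → ℝ} {M : Fin (K + 1) → S → S → ℝ}
  {w : Fin (K + 1) → ℝ} {t p a : ℝ}

section DoeblinHybrid
variable (κ : Fin m → Fin K) (φ : Fin m → Equiv.Perm S)

/-- **ARBITRARY REPLICAS ON `D₀` WITH A DOEBLIN-MINORISED HOT SAMPLER:** `g_j ≥ 0` of unit mass on `D₀` (anything),
`g_j = μ_j` off `D₀`: **`‖(⊗g)Pⁿ − π̃‖_TV ≤ ((2·#(D₀∖{0}) + p·𝟙{0 ∈ D₀})/p)·(1 − tcp/(2m))ⁿ`** once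
`4t ≤ p(1−t)·a·w_0`. [ours] -/
theorem doeblinHybridStart_tvDist_le (hm : 1 ≤ m) (ht0 : 0 ≤ t) (ht1 : t ≤ 1) (hw0 : ∀ k, 0 ≤ w k) (hw1 : ∑ k, w k = 1)
    (hμ : ∀ k x, 0 < μ k x) (hμ1 : ∀ k, ∑ u, μ k u = 1) (hM : ∀ k, IsRowStochastic (M k))
    (hstat : ∀ (k : Fin (K + 1)) (v : S), ∑ u, μ k u * M k u v = μ k v) (ha0 : 0 < a) (ha1 : a ≤ 1)
    (hmin : ∀ u v, a * μ 0 v ≤ M 0 u v)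
    (hp0 : 0 < p) (hp1 : p ≤ 1) (hdom : ∀ r u, p * μ (κ r).succ (φ r u) ≤ μ 0 u)
    (hreg : 4 * t ≤ p * (1 - t) * (a * w 0))
    {c : ℕ} (hc1 : 1 ≤ c) (hc : ∀ p' : Fin K, c ≤ (univ.filter (fun r : Fin m => κ r = p')).card) (hcm : c ≤ m)
    (D₀ : Finset (Fin (K + 1))) {g : Fin (K + 1) → S → ℝ} (hg0 : ∀ j u, 0 ≤ g j u) (hg1 : ∀ j, ∑ u, g j u = 1)
    (hgoff : ∀ j, j ∉ D₀ → ∀ u, g j u = μ j u) (n : ℕ) :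
    tvDist (lawAt (fun y z : Fin (K + 1) → S =>
          t * ptGraphSwap μ (fun r : Fin m => (((0 : Fin (K + 1)), (κ r).succ) : Fin (K + 1) × Fin (K + 1))) φ y z
          + (1 - t) * prodKernel w M y z) (tensorFun g) n) (tensorFun μ) ≤ (2 * ((D₀.erase 0).card : ℝ) + p * (if (0 : Fin (K + 1)) ∈ D₀ then (1 : ℝ) else 0)) / p * (1 - t * c * p / (2 * m)) ^ n := by
  set gpin : (Fin (K + 1) → S) → Fin (K + 1) → S → ℝ :=
    fun x j u => if j ∈ D₀ then (if u = x j then (1 : ℝ) else 0) else μ j u with hgpin_def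
  have hgpin : ∀ x j u, gpin x j u = if j ∈ D₀ then (if u = x j then (1 : ℝ) else 0) else μ j u := fun _ _ _ => rfl
  refine tvDist_lawAt_le_of_mixture _ _ (a := tensorFun g) (fun x => ?_) (sum_tensorFun_eq_one g hg1)
    (fun x => tensorFun (gpin x)) (hybridLaw_eq_mixture D₀ hgoff hg1 hgpin) n (fun x => ?_)
  · unfold tensorFun; exact Finset.prod_nonneg fun j _ => hg0 j (x j)
  · exact doeblinWarmStart_tvDist_le κ φ hm ht0 ht1 hw0 hw1 hμ hμ1 hM hstat ha0 ha1 hmin hp0 hp1 hdom hreg hc1 hc hcm D₀ x (hgpin x) n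

/-- **THE TIME FROM ARBITRARY REPLICAS ON `D₀`: `‖(⊗g)Pⁿ − π̃‖_TV ≤ ε` ONCE
`n ≥ (2m/(tcp))·log((2·#(D₀∖{0}) + p·𝟙{0∈D₀})/(pε))`** (`0 < t`, `D₀` non-empty). [ours] -/
theorem doeblinHybridStart_tvDist_le_of_ge_log (hm : 1 ≤ m) (ht0 : 0 < t) (ht1 : t ≤ 1) (hw0 : ∀ k, 0 ≤ w k) (hw1 : ∑ k, w k = 1)
    (hμ : ∀ k x, 0 < μ k x) (hμ1 : ∀ k, ∑ u, μ k u = 1) (hM : ∀ k, IsRowStochastic (M k))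
    (hstat : ∀ (k : Fin (K + 1)) (v : S), ∑ u, μ k u * M k u v = μ k v) (ha0 : 0 < a) (ha1 : a ≤ 1)
    (hmin : ∀ u v, a * μ 0 v ≤ M 0 u v)
    (hp0 : 0 < p) (hp1 : p ≤ 1) (hdom : ∀ r u, p * μ (κ r).succ (φ r u) ≤ μ 0 u)
    (hreg : 4 * t ≤ p * (1 - t) * (a * w 0))
    {c : ℕ} (hc1 : 1 ≤ c) (hc : ∀ p' : Fin K, c ≤ (univ.filter (fun r : Fin m => κ r = p')).card) (hcm : c ≤ m)
    (D₀ : Finset (Fin (K + 1))) (hD₀ : D₀.Nonempty) {g : Fin (K + 1) → S → ℝ} (hg0 : ∀ j u, 0 ≤ g j u)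
    (hg1 : ∀ j, ∑ u, g j u = 1) (hgoff : ∀ j, j ∉ D₀ → ∀ u, g j u = μ j u) {ε : ℝ} (hε : 0 < ε) {n : ℕ}
    (hn : 2 * (m : ℝ) / (t * c * p) * Real.log ((2 * ((D₀.erase 0).card : ℝ) + p * (if (0 : Fin (K + 1)) ∈ D₀ then (1 : ℝ) else 0)) / (p * ε)) ≤ n) :
    tvDist (lawAt (fun y z : Fin (K + 1) → S =>
          t * ptGraphSwap μ (fun r : Fin m => (((0 : Fin (K + 1)), (κ r).succ) : Fin (K + 1) × Fin (K + 1))) φ y z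
          + (1 - t) * prodKernel w M y z) (tensorFun g) n) (tensorFun μ) ≤ ε := by
  set gpin : (Fin (K + 1) → S) → Fin (K + 1) → S → ℝ :=
    fun x j u => if j ∈ D₀ then (if u = x j then (1 : ℝ) else 0) else μ j u with hgpin_def
  have hgpin : ∀ x j u, gpin x j u = if j ∈ D₀ then (if u = x j then (1 : ℝ) else 0) else μ j u := fun _ _ _ => rfl
  refine tvDist_lawAt_le_of_mixture _ _ (a := tensorFun g) (fun x => ?_) (sum_tensorFun_eq_one g hg1)
    (fun x => tensorFun (gpin x)) (hybridLaw_eq_mixture D₀ hgoff hg1 hgpin) n (fun x => ?_)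
  · unfold tensorFun; exact Finset.prod_nonneg fun j _ => hg0 j (x j)
  · exact doeblinWarmStart_tvDist_le_of_ge_log κ φ hm ht0 ht1 hw0 hw1 hμ hμ1 hM hstat ha0 ha1 hmin hp0 hp1 hdom hreg hc1 hc hcm D₀ hD₀ x (hgpin x) hε hn

/-- **THE TIME FROM APPROXIMATE REPLICAS WITH A DOEBLIN-MINORISED HOT SAMPLER: `‖(⊗g')Pⁿ − π̃‖_TV ≤ Σ_{j∉D₀} ε_j + ε`
ONCE `n ≥ (2m/(tcp))·log((2·#(D₀∖{0}) + p·𝟙{0∈D₀})/(pε))`** (`g'_j` arbitrary on `D₀`, `ε_j`-close to `μ_j` off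
`D₀`). [ours] -/
theorem doeblinApproxStart_tvDist_le_of_ge_log (hm : 1 ≤ m) (ht0 : 0 < t) (ht1 : t ≤ 1) (hw0 : ∀ k, 0 ≤ w k) (hw1 : ∑ k, w k = 1)
    (hμ : ∀ k x, 0 < μ k x) (hμ1 : ∀ k, ∑ u, μ k u = 1) (hM : ∀ k, IsRowStochastic (M k))
    (hstat : ∀ (k : Fin (K + 1)) (v : S), ∑ u, μ k u * M k u v = μ k v) (ha0 : 0 < a) (ha1 : a ≤ 1)
    (hmin : ∀ u v, a * μ 0 v ≤ M 0 u v)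
    (hp0 : 0 < p) (hp1 : p ≤ 1) (hdom : ∀ r u, p * μ (κ r).succ (φ r u) ≤ μ 0 u)
    (hreg : 4 * t ≤ p * (1 - t) * (a * w 0))
    {c : ℕ} (hc1 : 1 ≤ c) (hc : ∀ p' : Fin K, c ≤ (univ.filter (fun r : Fin m => κ r = p')).card) (hcm : c ≤ m)
    (D₀ : Finset (Fin (K + 1))) (hD₀ : D₀.Nonempty) {g' : Fin (K + 1) → S → ℝ} (hg0 : ∀ j u, 0 ≤ g' j u)
    (hg1 : ∀ j, ∑ u, g' j u = 1) {εj : Fin (K + 1) → ℝ} (hεj : ∀ j, j ∉ D₀ → tvDist (g' j) (μ j) ≤ εj j)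
    {ε : ℝ} (hε : 0 < ε) {n : ℕ}
    (hn : 2 * (m : ℝ) / (t * c * p) * Real.log ((2 * ((D₀.erase 0).card : ℝ) + p * (if (0 : Fin (K + 1)) ∈ D₀ then (1 : ℝ) else 0)) / (p * ε)) ≤ n) :
    tvDist (lawAt (fun y z : Fin (K + 1) → S =>
          t * ptGraphSwap μ (fun r : Fin m => (((0 : Fin (K + 1)), (κ r).succ) : Fin (K + 1) × Fin (K + 1))) φ y z
          + (1 - t) * prodKernel w M y z) (tensorFun g') n) (tensorFun μ) ≤ ∑ j ∈ univ.filter (fun j => j ∉ D₀), εj j + ε := by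
  -- the hybrid law `g` (= `g'` on `D₀`, `μ` off `D₀`)
  set g : Fin (K + 1) → S → ℝ := fun j u => if j ∈ D₀ then g' j u else μ j u with hg_def
  have hG0 : ∀ j u, 0 ≤ g j u := fun j u => by rw [hg_def]; dsimp only; split_ifs; exacts [hg0 j u, (hμ j u).le]
  have hG1 : ∀ j, ∑ u, g j u = 1 := fun j => by
    simp only [hg_def]; split_ifs; exacts [hg1 j, hμ1 j]
  have hGoff : ∀ j, j ∉ D₀ → ∀ u, g j u = μ j u := fun j hj u => by simp only [hg_def, if_neg hj]
  have hP : IsRowStochastic (fun y z : Fin (K + 1) → S =>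
          t * ptGraphSwap μ (fun r : Fin m => (((0 : Fin (K + 1)), (κ r).succ) : Fin (K + 1) × Fin (K + 1))) φ y z
          + (1 - t) * prodKernel w M y z) :=
    weightedScheme_isRowStochastic (ptGraphSwap_isRowStochastic hμ) hM hw0 hw1 ht0.le ht1
  have hclose : tvDist (tensorFun g') (tensorFun g) ≤ ∑ j ∈ univ.filter (fun j => j ∉ D₀), εj j := by
    refine (LevinPeres2017_exercise_4_4 hg0 hG0 hg1 hG1).trans ?_
    rw [← Finset.sum_filter_add_sum_filter_not univ (fun j : Fin (K + 1) => j ∉ D₀)]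
    have hzero : ∑ j ∈ univ.filter (fun j : Fin (K + 1) => ¬ j ∉ D₀), tvDist (g' j) (g j) = 0 := by
      refine Finset.sum_eq_zero fun j hj => ?_
      have hj' : j ∈ D₀ := not_not.mp (Finset.mem_filter.mp hj).2
      have : g j = g' j := funext fun u => by simp only [hg_def, if_pos hj']
      rw [this, tvDist_self]
    rw [hzero, add_zero]
    refine Finset.sum_le_sum fun j hj => ?_
    have hj' : j ∉ D₀ := (Finset.mem_filter.mp hj).2
    have : g j = μ j := funext fun u => hGoff j hj' u
    rw [this]; exact hεj j hj'
  have hhyb := doeblinHybridStart_tvDist_le_of_ge_log κ φ hm ht0 ht1 hw0 hw1 hμ hμ1 hM hstat ha0 ha1 hmin hp0 hp1 hdom hreg hc1 hc hcm D₀ hD₀ hG0 hG1 hGoff hε hn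
  exact (tvDist_lawAt_le_of_close_start hP _ (tensorFun g) (tensorFun g') n).trans (add_le_add hclose hhyb)

/-- **UNIFORM LISTING (`m = cK`): `‖(⊗g')Pⁿ − π̃‖_TV ≤ Σ_{j∉D₀} ε_j + ε` ONCE
`n ≥ (2K/(tp))·log((2·#(D₀∖{0}) + p·𝟙{0∈D₀})/(pε))`.** [ours] -/
theorem uniformDoeblinApproxStart_tvDist_le_of_ge_log (hK : 1 ≤ K) (ht0 : 0 < t) (ht1 : t ≤ 1) (hw0 : ∀ k, 0 ≤ w k) (hw1 : ∑ k, w k = 1)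
    (hμ : ∀ k x, 0 < μ k x) (hμ1 : ∀ k, ∑ u, μ k u = 1) (hM : ∀ k, IsRowStochastic (M k))
    (hstat : ∀ (k : Fin (K + 1)) (v : S), ∑ u, μ k u * M k u v = μ k v) (ha0 : 0 < a) (ha1 : a ≤ 1)
    (hmin : ∀ u v, a * μ 0 v ≤ M 0 u v)
    (hp0 : 0 < p) (hp1 : p ≤ 1) (hdom : ∀ r u, p * μ (κ r).succ (φ r u) ≤ μ 0 u)
    (hreg : 4 * t ≤ p * (1 - t) * (a * w 0))
    {c : ℕ} (hc1 : 1 ≤ c) (hc : ∀ p' : Fin K, c ≤ (univ.filter (fun r : Fin m => κ r = p')).card)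
    (hmc : m = c * K) (D₀ : Finset (Fin (K + 1))) (hD₀ : D₀.Nonempty) {g' : Fin (K + 1) → S → ℝ}
    (hg0 : ∀ j u, 0 ≤ g' j u) (hg1 : ∀ j, ∑ u, g' j u = 1) {εj : Fin (K + 1) → ℝ}
    (hεj : ∀ j, j ∉ D₀ → tvDist (g' j) (μ j) ≤ εj j) {ε : ℝ} (hε : 0 < ε) {n : ℕ}
    (hn : 2 * (K : ℝ) / (t * p) * Real.log ((2 * ((D₀.erase 0).card : ℝ) + p * (if (0 : Fin (K + 1)) ∈ D₀ then (1 : ℝ) else 0)) / (p * ε)) ≤ n) :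
    tvDist (lawAt (fun y z : Fin (K + 1) → S =>
          t * ptGraphSwap μ (fun r : Fin m => (((0 : Fin (K + 1)), (κ r).succ) : Fin (K + 1) × Fin (K + 1))) φ y z
          + (1 - t) * prodKernel w M y z) (tensorFun g') n) (tensorFun μ) ≤ ∑ j ∈ univ.filter (fun j => j ∉ D₀), εj j + ε := by
  have hm : 1 ≤ m := by rw [hmc]; exact Nat.one_le_iff_ne_zero.mpr (Nat.mul_ne_zero (by omega) (by omega))
  have hcm : c ≤ m := by rw [hmc]; exact Nat.le_mul_of_pos_right c (by omega)
  have hcpos : (0 : ℝ) < c := Nat.cast_pos.mpr (by omega)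
  have e : 2 * (m : ℝ) / (t * c * p) = 2 * (K : ℝ) / (t * p) := by
    rw [hmc, Nat.cast_mul]; field_simp
  exact doeblinApproxStart_tvDist_le_of_ge_log κ φ hm ht0 ht1 hw0 hw1 hμ hμ1 hM hstat ha0 ha1 hmin hp0 hp1 hdom hreg hc1 hc hcm D₀ hD₀ hg0 hg1 hεj hε (by rw [e]; exact hn)

end DoeblinHybrid

end Summit.Ventures.LatticeQCDFlow.Scaling

end
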